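import Literature.Geometry.DiscreteGeometry.ThreePointBoundGeneral

/-!
# The equality case of the Bachoc–Vallentin three-point bound: the gap identity and complementary slackness

Framing: lottery ticket; floor = certified bounds/negative ranges. Venture `PackingBounds` (cell
`pub-packcert`, recognition seat, RECOG.md §22 T5-INTEGER).

`Literature.Geometry.DiscreteGeometry.BachocVallentin.card_le_of_threePoint` proves the abstract
three-point bound `|C| ≤ 1 + A(1) + b₁₁ + F(1,1,1)` by DROPPING five nonnegative quantities. This file
records the exact bookkeeping identity behind that proof (`gap_eq`): for every finite set `C` of unit
vectors of `ℝⁿ` (no feasibility hypothesis at all),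
```
|C| · (1 + A(1) + b₁₁ + F(1,1,1)) − |C|²
    = Σ_{x,y∈C} A(x·y) + Σ_{x,y,z∈C} F(x·y, x·z, y·z)
      + Σ_{x≠y} ((−1 − 2b₁₂ − b₂₂) − (A(x·y) + 3F(x·y, x·y, 1)))
      + Σ_{x,y,z distinct} (−b₂₂ − F(x·y, x·z, y·z))
      + |C| · (b₁₁ + 2b₁₂(|C|−1) + b₂₂(|C|−1)²),
```
and the consequence used for codes whose size EQUALS the bound (`tight_slack_eq_zero` and
companions; the slacks are written out inline, no new definitions): if the five terms are nonnegative (the hypotheses of the bound) and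
`|C| = 1 + A(1) + b₁₁ + F(1,1,1)`, then each term vanishes; in particular the univariate slack
vanishes at EVERY inner product of two distinct code points, the two-point sum `Σ A` is zero and the
three-point sum `Σ F` is zero (complementary slackness). This is the mechanism by which an exact
certificate whose bound is an INTEGER `N` constrains every hypothetical `N`-point code (recognition
seat, T5.md §5: the cell `(n, s) = (10, 1/10)`, bound exactly 27).

What is NOT here: any specific certificate, and the final arithmetic/graph-theoretic contradiction
for `(10, 1/10)` (T5.md §5 (3)); those live with the certificate files.

## References
* C. Bachoc, F. Vallentin, J. Amer. Math. Soc. 21 (2008) 909–924, Theorem 4.2 and its proof (§4).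
  [`BachocVallentin2007`]
-/

noncomputable section

open Finset
open scoped RealInnerProductSpace

namespace Summit.Ventures.PackingBounds.SphericalCodes

open Literature.Geometry.DiscreteGeometry

variable {n : ℕ}

/-- **Gap identity behind Bachoc–Vallentin Theorem 4.2.** For ANY finite set `C` of unit vectors of
`ℝⁿ`, any `A`, any `F` symmetric in the sense `F u v t = F v u t = F u t v`, and any `b₁₁, b₁₂, b₂₂`,
`|C|·(1 + A 1 + b₁₁ + F 1 1 1) − |C|²` equals the sum of: the two-point sum `Σ_{x,y∈C} A(x·y)`, the
three-point sum `Σ_{x,y,z∈C} F`, the univariate slacks over ordered pairs of distinct points, the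
trivariate slacks over ordered triples of distinct points, and `|C|·(b₁₁ + 2b₁₂(|C|−1) + b₂₂(|C|−1)²)`.
(Pure bookkeeping: split the double and triple sums by coincidences `x = y`, `x = z`, `y = z`.) -/
theorem gap_eq (C : Finset (EuclideanSpace ℝ (Fin n))) (hC : ∀ x ∈ C, ‖x‖ = 1)
    (A : ℝ → ℝ) (F : ℝ → ℝ → ℝ → ℝ) (b11 b12 b22 : ℝ)
    (hF12 : ∀ u v t, F u v t = F v u t) (hF23 : ∀ u v t, F u v t = F u t v) :
    (C.card : ℝ) * (1 + A 1 + b11 + F 1 1 1) - (C.card : ℝ) ^ 2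
      = BachocVallentin.pairSum C A + BachocVallentin.tripleSum C F
        + (∑ x ∈ C, ∑ y ∈ C.erase x, ((-1 - 2 * b12 - b22) - (A (inner ℝ x y) + 3 * F (inner ℝ x y) (inner ℝ x y) 1)))
        + (∑ x ∈ C, ∑ y ∈ C.erase x, ∑ z ∈ (C.erase x).erase y,
            (-b22 - F (inner ℝ x y) (inner ℝ x z) (inner ℝ y z)))
        + (C.card : ℝ) * (b11 + 2 * b12 * ((C.card : ℝ) - 1) + b22 * ((C.card : ℝ) - 1) ^ 2) := by
  classical
  set M : ℝ := (C.card : ℝ) with hM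
  have hself : ∀ x ∈ C, inner ℝ x x = (1 : ℝ) := fun x hx => by
    rw [real_inner_self_eq_norm_sq, hC x hx]; norm_num
  -- cardinalities of punctured sets
  have hcard1 : ∀ x ∈ C, ((C.erase x).card : ℝ) = M - 1 := by
    intro x hx
    rw [Finset.card_erase_of_mem hx, Nat.cast_sub (Finset.card_pos.2 ⟨x, hx⟩), hM]; simp
  have hcard2 : ∀ x ∈ C, ∀ y ∈ C.erase x, (((C.erase x).erase y).card : ℝ) = M - 2 := by
    intro x hx y hy
    have h2 : 2 ≤ C.card := by
      have : (C.erase x).card = C.card - 1 := Finset.card_erase_of_mem hx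
      have hp : 0 < (C.erase x).card := Finset.card_pos.2 ⟨y, hy⟩
      omega
    rw [Finset.card_erase_of_mem hy, Finset.card_erase_of_mem hx, Nat.sub_sub,
      Nat.cast_sub h2, hM]
    norm_num
  -- split the pair sum
  have hpair : BachocVallentin.pairSum C A = M * A 1 + ∑ x ∈ C, ∑ y ∈ C.erase x, A (inner ℝ x y) := by
    unfold BachocVallentin.pairSum
    rw [show M * A 1 = ∑ x ∈ C, A 1 by rw [Finset.sum_const, nsmul_eq_mul, hM],
      ← Finset.sum_add_distrib]
    refine Finset.sum_congr rfl fun x hx => ?_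
    rw [← Finset.add_sum_erase C _ hx, hself x hx]
  -- split the triple sum
  have htriple : BachocVallentin.tripleSum C F = M * F 1 1 1
      + 3 * ∑ x ∈ C, ∑ y ∈ C.erase x, F (inner ℝ x y) (inner ℝ x y) 1
      + ∑ x ∈ C, ∑ y ∈ C.erase x, ∑ z ∈ (C.erase x).erase y,
          F (inner ℝ x y) (inner ℝ x z) (inner ℝ y z) := by
    unfold BachocVallentin.tripleSum
    have hx_split : ∀ x ∈ C,
        (∑ y ∈ C, ∑ z ∈ C, F (inner ℝ x y) (inner ℝ x z) (inner ℝ y z)) =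
          F 1 1 1 + 3 * ∑ y ∈ C.erase x, F (inner ℝ x y) (inner ℝ x y) 1 +
            ∑ y ∈ C.erase x, ∑ z ∈ (C.erase x).erase y,
              F (inner ℝ x y) (inner ℝ x z) (inner ℝ y z) := by
      intro x hx
      rw [← Finset.add_sum_erase C _ hx]
      have hyx : (∑ z ∈ C, F (inner ℝ x x) (inner ℝ x z) (inner ℝ x z)) =
          F 1 1 1 + ∑ z ∈ C.erase x, F (inner ℝ x z) (inner ℝ x z) 1 := by
        rw [← Finset.add_sum_erase C _ hx, hself x hx]
        congr 1
        refine Finset.sum_congr rfl fun z _ => ?_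
        rw [hF12, hF23]
      have hyne : ∀ y ∈ C.erase x,
          (∑ z ∈ C, F (inner ℝ x y) (inner ℝ x z) (inner ℝ y z)) =
            2 * F (inner ℝ x y) (inner ℝ x y) 1 +
              ∑ z ∈ (C.erase x).erase y, F (inner ℝ x y) (inner ℝ x z) (inner ℝ y z) := by
        intro y hy
        have hyC : y ∈ C := Finset.mem_of_mem_erase hy
        rw [← Finset.add_sum_erase C _ hx, ← Finset.add_sum_erase (C.erase x) _ hy, hself x hx,
          hself y hyC, real_inner_comm x y]
        have e1 : F (inner ℝ x y) 1 (inner ℝ x y) = F (inner ℝ x y) (inner ℝ x y) 1 := by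
          rw [hF23]
        rw [e1]; ring
      rw [hyx, Finset.sum_congr rfl hyne, Finset.sum_add_distrib, ← Finset.mul_sum]
      ring
    rw [Finset.sum_congr rfl hx_split, Finset.sum_add_distrib, Finset.sum_add_distrib,
      Finset.sum_const, nsmul_eq_mul, ← hM, ← Finset.mul_sum]
  -- constant sums over punctured sets
  have hconst1 : ∀ c : ℝ, (∑ x ∈ C, ∑ y ∈ C.erase x, c) = M * (M - 1) * c := by
    intro c
    have : ∀ x ∈ C, (∑ y ∈ C.erase x, c) = (M - 1) * c := by
      intro x hx
      rw [Finset.sum_const, nsmul_eq_mul, hcard1 x hx]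
    rw [Finset.sum_congr rfl this, Finset.sum_const, nsmul_eq_mul, ← hM]; ring
  have hconst2 : ∀ c : ℝ,
      (∑ x ∈ C, ∑ y ∈ C.erase x, ∑ z ∈ (C.erase x).erase y, c) = M * (M - 1) * (M - 2) * c := by
    intro c
    have hin : ∀ x ∈ C, ∀ y ∈ C.erase x, (∑ z ∈ (C.erase x).erase y, c) = (M - 2) * c := by
      intro x hx y hy
      rw [Finset.sum_const, nsmul_eq_mul, hcard2 x hx y hy]
    have hmid : ∀ x ∈ C, (∑ y ∈ C.erase x, ∑ z ∈ (C.erase x).erase y, c)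
        = (M - 1) * ((M - 2) * c) := by
      intro x hx
      rw [Finset.sum_congr rfl (hin x hx), Finset.sum_const, nsmul_eq_mul, hcard1 x hx]
    rw [Finset.sum_congr rfl hmid, Finset.sum_const, nsmul_eq_mul, ← hM]; ring
  -- the slack sums, expanded
  have hslackI : (∑ x ∈ C, ∑ y ∈ C.erase x, ((-1 - 2 * b12 - b22) - (A (inner ℝ x y) + 3 * F (inner ℝ x y) (inner ℝ x y) 1)))
      = M * (M - 1) * (-1 - 2 * b12 - b22)
        - (∑ x ∈ C, ∑ y ∈ C.erase x, A (inner ℝ x y))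
        - 3 * ∑ x ∈ C, ∑ y ∈ C.erase x, F (inner ℝ x y) (inner ℝ x y) 1 := by
    have hin : ∀ x ∈ C, (∑ y ∈ C.erase x, ((-1 - 2 * b12 - b22) - (A (inner ℝ x y) + 3 * F (inner ℝ x y) (inner ℝ x y) 1)))
        = (M - 1) * (-1 - 2 * b12 - b22) - (∑ y ∈ C.erase x, A (inner ℝ x y))
          - 3 * ∑ y ∈ C.erase x, F (inner ℝ x y) (inner ℝ x y) 1 := by
      intro x hx
      rw [Finset.sum_sub_distrib, Finset.sum_add_distrib, Finset.sum_const, nsmul_eq_mul,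
        hcard1 x hx, ← Finset.mul_sum]
      ring
    rw [Finset.sum_congr rfl hin, Finset.sum_sub_distrib, Finset.sum_sub_distrib, Finset.sum_const,
      nsmul_eq_mul, ← hM, ← Finset.mul_sum]
    ring
  have hslackII : (∑ x ∈ C, ∑ y ∈ C.erase x, ∑ z ∈ (C.erase x).erase y,
        (-b22 - F (inner ℝ x y) (inner ℝ x z) (inner ℝ y z)))
      = M * (M - 1) * (M - 2) * (-b22)
        - ∑ x ∈ C, ∑ y ∈ C.erase x, ∑ z ∈ (C.erase x).erase y,
            F (inner ℝ x y) (inner ℝ x z) (inner ℝ y z) := by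
    have hin : ∀ x ∈ C, ∀ y ∈ C.erase x,
        (∑ z ∈ (C.erase x).erase y, (-b22 - F (inner ℝ x y) (inner ℝ x z) (inner ℝ y z)))
          = (M - 2) * (-b22) - ∑ z ∈ (C.erase x).erase y, F (inner ℝ x y) (inner ℝ x z) (inner ℝ y z) := by
      intro x hx y hy
      rw [Finset.sum_sub_distrib, Finset.sum_const, nsmul_eq_mul, hcard2 x hx y hy]
    have hmid : ∀ x ∈ C, (∑ y ∈ C.erase x, ∑ z ∈ (C.erase x).erase y,
        (-b22 - F (inner ℝ x y) (inner ℝ x z) (inner ℝ y z)))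
          = (M - 1) * ((M - 2) * (-b22))
            - ∑ y ∈ C.erase x, ∑ z ∈ (C.erase x).erase y, F (inner ℝ x y) (inner ℝ x z) (inner ℝ y z) := by
      intro x hx
      rw [Finset.sum_congr rfl (hin x hx), Finset.sum_sub_distrib, Finset.sum_const, nsmul_eq_mul,
        hcard1 x hx]
    rw [Finset.sum_congr rfl hmid, Finset.sum_sub_distrib, Finset.sum_const, nsmul_eq_mul, ← hM]
    ring
  rw [hslackI, hslackII, hpair, htriple, hM]
  ring

/-- **Complementary slackness at equality (Bachoc–Vallentin Thm 4.2).** Under the hypotheses of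
`BachocVallentin.card_le_of_threePoint` (two-point sum `≥ 0`, three-point sum `≥ 0`, `B ⪰ 0` as a
quadratic form, univariate condition (i) on `[-1, s]`, trivariate condition (ii) on the domain `D'`),
if the code ATTAINS the bound, `|C| = 1 + A 1 + b₁₁ + F 1 1 1`, then: the univariate slack vanishes at
every inner product of two distinct code points, the two-point sum `Σ_{x,y} A(x·y)` is `0`, and the
three-point sum `Σ_{x,y,z} F` is `0`. -/
theorem tight_slack_eq_zero (s : ℝ) (C : Finset (EuclideanSpace ℝ (Fin n)))
    (hC : ∀ x ∈ C, ‖x‖ = 1) (hcode : ∀ x ∈ C, ∀ y ∈ C, x ≠ y → inner ℝ x y ≤ s)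
    (A : ℝ → ℝ) (F : ℝ → ℝ → ℝ → ℝ) (b11 b12 b22 : ℝ)
    (hA : 0 ≤ BachocVallentin.pairSum C A) (hF : 0 ≤ BachocVallentin.tripleSum C F)
    (hF12 : ∀ u v t, F u v t = F v u t) (hF23 : ∀ u v t, F u v t = F u t v)
    (hb : ∀ l : ℝ, 0 ≤ b11 + 2 * b12 * l + b22 * l ^ 2)
    (h1 : ∀ u : ℝ, -1 ≤ u → u ≤ s → A u + 3 * F u u 1 ≤ -1 - 2 * b12 - b22)
    (h2 : ∀ u v t : ℝ, -1 ≤ u → u ≤ s → -1 ≤ v → v ≤ s → -1 ≤ t → t ≤ s →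
      0 ≤ 1 + 2 * u * v * t - u ^ 2 - v ^ 2 - t ^ 2 → F u v t ≤ -b22)
    (htight : (C.card : ℝ) = 1 + A 1 + b11 + F 1 1 1) :
    (∀ x ∈ C, ∀ y ∈ C, x ≠ y → ((-1 - 2 * b12 - b22) - (A (inner ℝ x y) + 3 * F (inner ℝ x y) (inner ℝ x y) 1)) = 0)
      ∧ BachocVallentin.pairSum C A = 0 ∧ BachocVallentin.tripleSum C F = 0 := by
  classical
  have hself : ∀ x ∈ C, inner ℝ x x = (1 : ℝ) := fun x hx => by
    rw [real_inner_self_eq_norm_sq, hC x hx]; norm_num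
  have hrange : ∀ x ∈ C, ∀ y ∈ C, x ≠ y → -1 ≤ inner ℝ x y ∧ inner ℝ x y ≤ s := by
    intro x hx y hy hxy
    refine ⟨?_, hcode x hx y hy hxy⟩
    have h := abs_real_inner_le_norm x y
    rw [hC x hx, hC y hy, mul_one] at h
    exact (abs_le.1 h).1
  -- nonnegativity of every slack term
  have hsI : ∀ x ∈ C, ∀ y ∈ C.erase x, 0 ≤ ((-1 - 2 * b12 - b22) - (A (inner ℝ x y) + 3 * F (inner ℝ x y) (inner ℝ x y) 1)) := by
    intro x hx y hy
    have hyC : y ∈ C := Finset.mem_of_mem_erase hy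
    have hxy : x ≠ y := fun h => (Finset.ne_of_mem_erase hy) h.symm
    obtain ⟨lo, hi⟩ := hrange x hx y hyC hxy
    have := h1 _ lo hi
    linarith
  have hsII : ∀ x ∈ C, ∀ y ∈ C.erase x, ∀ z ∈ (C.erase x).erase y,
      0 ≤ (-b22 - F (inner ℝ x y) (inner ℝ x z) (inner ℝ y z)) := by
    intro x hx y hy z hz
    have hyC : y ∈ C := Finset.mem_of_mem_erase hy
    have hxy : x ≠ y := fun h => (Finset.ne_of_mem_erase hy) h.symm
    have hz1 : z ∈ C.erase x := Finset.mem_of_mem_erase hz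
    have hzC : z ∈ C := Finset.mem_of_mem_erase hz1
    have hzy : z ≠ y := Finset.ne_of_mem_erase hz
    have hzx : z ≠ x := Finset.ne_of_mem_erase hz1
    obtain ⟨lo1, hi1⟩ := hrange x hx y hyC hxy
    obtain ⟨lo2, hi2⟩ := hrange x hx z hzC hzx.symm
    obtain ⟨lo3, hi3⟩ := hrange y hyC z hzC hzy.symm
    have := h2 _ _ _ lo1 hi1 lo2 hi2 lo3 hi3
      (BachocVallentin.gram3_nonneg x y z (hC x hx) (hC y hyC) (hC z hzC))
    linarith
  have hS1 : 0 ≤ ∑ x ∈ C, ∑ y ∈ C.erase x, ((-1 - 2 * b12 - b22) - (A (inner ℝ x y) + 3 * F (inner ℝ x y) (inner ℝ x y) 1)) :=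
    Finset.sum_nonneg fun x hx => Finset.sum_nonneg fun y hy => hsI x hx y hy
  have hS2 : 0 ≤ ∑ x ∈ C, ∑ y ∈ C.erase x, ∑ z ∈ (C.erase x).erase y,
      (-b22 - F (inner ℝ x y) (inner ℝ x z) (inner ℝ y z)) :=
    Finset.sum_nonneg fun x hx => Finset.sum_nonneg fun y hy =>
      Finset.sum_nonneg fun z hz => hsII x hx y hy z hz
  have hB : 0 ≤ (C.card : ℝ) * (b11 + 2 * b12 * ((C.card : ℝ) - 1) + b22 * ((C.card : ℝ) - 1) ^ 2) :=
    mul_nonneg (Nat.cast_nonneg _) (hb _)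
  have hgap := gap_eq C hC A F b11 b12 b22 hF12 hF23
  have hzero : (C.card : ℝ) * (1 + A 1 + b11 + F 1 1 1) - (C.card : ℝ) ^ 2 = 0 := by
    rw [← htight]; ring
  rw [hzero] at hgap
  -- all five nonnegative terms vanish
  have hA0 : BachocVallentin.pairSum C A = 0 := by linarith
  have hF0 : BachocVallentin.tripleSum C F = 0 := by linarith
  have hS10 : (∑ x ∈ C, ∑ y ∈ C.erase x, ((-1 - 2 * b12 - b22) - (A (inner ℝ x y) + 3 * F (inner ℝ x y) (inner ℝ x y) 1))) = 0 := by linarith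
  refine ⟨?_, hA0, hF0⟩
  intro x hx y hy hxy
  have hyE : y ∈ C.erase x := Finset.mem_erase.2 ⟨fun h => hxy h.symm, hy⟩
  have hrow := (Finset.sum_eq_zero_iff_of_nonneg
    (fun x' hx' => Finset.sum_nonneg fun y' hy' => hsI x' hx' y' hy')).1 hS10 x hx
  exact (Finset.sum_eq_zero_iff_of_nonneg (fun y' hy' => hsI x hx y' hy')).1 hrow y hyE

/-- Corollary for the two-point part written as a nonnegative combination of individually
nonnegative two-point sums (as in a certificate `A = Σ_k a_k P_k`): at equality, every summand
`a_k · Σ_{x,y} P_k(x·y)` with `a_k > 0` has `Σ_{x,y} P_k(x·y) = 0`. Stated for one distinguished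
component: if `A = A' + a • P` with `Σ A' ≥ 0`, `Σ P ≥ 0`, `a > 0` and `Σ A = 0`, then `Σ P = 0`.
(Used with `P(u) = u`: then `Σ_{x,y} x·y = ‖Σ_x x‖² = 0`, i.e. a tight code is centred whenever
`a_1 > 0`.) -/
theorem pairSum_component_eq_zero (C : Finset (EuclideanSpace ℝ (Fin n)))
    (A' P : ℝ → ℝ) (a : ℝ) (ha : 0 < a) (hA' : 0 ≤ BachocVallentin.pairSum C A')
    (hP : 0 ≤ BachocVallentin.pairSum C P)
    (hsum : BachocVallentin.pairSum C (fun u => A' u + a * P u) = 0) :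
    BachocVallentin.pairSum C P = 0 := by
  have hsplit : BachocVallentin.pairSum C (fun u => A' u + a * P u)
      = BachocVallentin.pairSum C A' + a * BachocVallentin.pairSum C P := by
    unfold BachocVallentin.pairSum
    simp only [Finset.sum_add_distrib, Finset.mul_sum]
  rw [hsplit] at hsum
  have h1 : a * BachocVallentin.pairSum C P ≤ 0 := by linarith
  have h2 : BachocVallentin.pairSum C P ≤ 0 := by
    by_contra h
    have h' : 0 < BachocVallentin.pairSum C P := lt_of_not_ge h
    have := mul_pos ha h'
    linarith
  linarith

/-- The two-point sum of the identity kernel is the squared norm of the centre of mass: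
`Σ_{x,y∈C} x·y = ‖Σ_{x∈C} x‖²`; in particular it vanishes iff the code is centred. -/
theorem pairSum_id_eq_norm_sq (C : Finset (EuclideanSpace ℝ (Fin n))) :
    BachocVallentin.pairSum C (fun u => u) = ‖∑ x ∈ C, x‖ ^ 2 := by
  unfold BachocVallentin.pairSum
  rw [← real_inner_self_eq_norm_sq, sum_inner]
  refine Finset.sum_congr rfl fun x _ => ?_
  rw [inner_sum]

end Summit.Ventures.PackingBounds.SphericalCodes

end
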